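import Summits.CriticalPhenomena.PercolationContinuityZ3.Theorems.PercNearOneGluingNoHeavyLowerTailKnQuestion8CoefficientwiseOffCluster
import Summits.CriticalPhenomena.PercolationContinuityZ3.Theorems.PercNearOneGluingNoHeavyLowerTailKnQuestion8CoefficientwiseGluing
import HarnessLib

/-!
# The REACH reduction: the decided-weight two-colouring inequality `T'' ≥ 0` follows cellwise from the gadget REACH principle

Support file (`--supports stmt-CriticalPhenomena-4575`, closed), prover `prim-lf-2` (gen 40).  No definitions, no named facts, no sorries;
standard axioms.  Memo `prim-lf-2/CW-GINIBRE-gen40.md` §3; notation of `prim-lf-2/CW-PROGRAMME-gen21.md`, `prim-lf-2/CW-TLEMMA-gen23.md`.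

Setting.  A finite multigraph `ends : ι → Sym2 V`, a root `x`, colourings `s : Finset ι` (red) / `sᶜ` (blue), `C(s) = openCluster (ends '' s) x`,
monotone `f, g : Set V → ℝ`, `Δf(s) = f(C s) − f(C sᶜ)`.  prim-lf-2 gen 23 proved the OFF-CLUSTER inequality `Σ_{s : z ∉ C s} Δf Δg ≥ 0`
(`offCluster_twoColouring_nonneg`); together with the colour swap it is the decomposition `Harris = off-cluster + REACH`, where
  REACH(z) := `Σ_{s : z ∈ C s} Δf(s) Δg(s)`.
prim-lf-2 gen 40 found by exhaustive census (all graphs `n ≤ 6`, multigraphs `n ≤ 5`, 1.2·10⁶ random gadget instances `n ≤ 10`, general up-set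
pairs `f, g`; 0 negatives) that REACH is the dual companion of the off-cluster theorem, in the following GADGET form.  A *gadget instance* is a set
`E` of free edges (coloured `ω ⊆ E` red, `E ∖ ω` blue) together with a disjoint set `Γ` of edges that are always red and usable by the red
cluster only: `K(ω) = C(ω ∪ Γ)`, `K̄(ω) = C(E ∖ ω)`.
  CONJECTURE REACH (prim-lf-2 gen 40):  `0 ≤ Σ_{ω ⊆ E} 1{z ∈ K(ω)} · (f K(ω) − f K̄(ω)) · (g K(ω) − g K̄(ω))`.
Without the weight `1{z ∈ K}` this is a theorem (`gadget_harris_twoColouring` below: the differences are monotone in `ω` with non-negative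
means, since `C(ω ∪ Γ) ⊇ C(ω)` and `ω ↦ E ∖ ω` preserves the counting measure; then FKG).  With the weight and `Γ = ∅` it contains the
'SSR' row of the gen-40 Griffiths census; the 4-point Griffiths inequality `Σ σ_a σ_b σ_c σ_d ≥ 0` implies its decided variant below for points.
* `Coefficientwise.gadget_harris_twoColouring` — THEOREM: the weight-free gadget inequality.
* `Coefficientwise.decided_twoColouring_nonneg_of_reach` — THEOREM (reduction): if REACH holds for the gadget instances of `ends` (same `x, z,
  f, g`), then `0 ≤ Σ_{s : z ∈ C(s), z ∉ C(sᶜ)} Δf(s) Δg(s)` — the DECIDED-weight inequality, i.e. `T''(z) = E[1{z ∈ K̄ ∖ K} Δf Δg] ≥ 0` of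
  CW-PROGRAMME-gen21 (open since gen 21; census 112 300 / 0), equivalently (swap) `E[1{z ∈ K △ K̄} Δf Δg] ≥ 0`.
Proof of the reduction: freeze the BLUE cluster `S` of `z` (it avoids `x`) together with the colours of the edges `I(S)` at `S`; the event
`{z ∉ C(sᶜ)}` is a disjoint union of cells `{t | t ∩ I(S) = π}`; on a cell the blue cluster of `x` uses no edge at `S`
(`C(tᶜ) = C(tᶜ ∖ I(S))`) while the red cluster is `C((t ∖ I(S)) ∪ π)`, so the cell sum is literally the REACH sum of the gadget instance
`(E, Γ) = (I(S)ᶜ, π)` — the red edges at `S` are the gadget.  (Dual to gen 23: there the RED cluster of the avoided set was frozen and the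
cell was an instance of the weight-free inequality with a blue gadget.)
[cite: KozmaNitzan2024, Questions 8–9 (§5.5 p. 36) (context: the Question-8 pocket covariance programme)]
-/

namespace Summit.CriticalPhenomena.PercolationContinuityZ3.Theorems

open Finset Literature.Probability.Percolation

namespace Coefficientwise

variable {ι V : Type*} [Fintype ι] [DecidableEq ι]

open Classical in
/-- **Weight-free gadget inequality** (the `1 ≡ 1{z ∈ K}`-free shadow of REACH).  For a gadget instance `(E, Γ)` — free edges `E`, always-red
edges `Γ` — a root `x` and monotone `f, g`:
`0 ≤ Σ_{ω ⊆ E} (f C(ω ∪ Γ) − f C(E ∖ ω)) · (g C(ω ∪ Γ) − g C(E ∖ ω))`.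
Proof: both differences are monotone in `ω`; their sums over `ω ⊆ E` are `≥ 0` because `C(ω ∪ Γ) ⊇ C(ω)` and `Σ_ω h(E ∖ ω) = Σ_ω h(ω)`;
FKG on `E.powerset` (`fkg_powerset`).  [cite: KozmaNitzan2024, §5.5 (context only; the inequality used is Fortuin–Kasteleyn–Ginibre / Harris)] -/
theorem gadget_harris_twoColouring (ends : ι → Sym2 V) (E Γ : Finset ι) (x : V) (f g : Set V → ℝ)
    (hf : Monotone f) (hg : Monotone g) :
    0 ≤ ∑ ω ∈ E.powerset,
      (f (openCluster (ends '' (↑(ω ∪ Γ) : Set ι)) x) - f (openCluster (ends '' (↑(E \ ω) : Set ι)) x)) *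
        (g (openCluster (ends '' (↑(ω ∪ Γ) : Set ι)) x) - g (openCluster (ends '' (↑(E \ ω) : Set ι)) x)) := by
  set C : Finset ι → Set V := fun s => openCluster (ends '' (↑s : Set ι)) x with hC
  have hCm : ∀ {s s' : Finset ι}, s ⊆ s' → C s ⊆ C s' := fun h => openCluster_image_mono ends h x
  -- monotone extensions of the two differences to all of `Finset ι`
  set Φ : Finset ι → ℝ := fun ω => f (C ((ω ∩ E) ∪ Γ)) - f (C (E \ ω)) with hΦ
  set Ψ : Finset ι → ℝ := fun ω => g (C ((ω ∩ E) ∪ Γ)) - g (C (E \ ω)) with hΨ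
  have hΦm : Monotone Φ := by
    intro a b hab
    have h1 : f (C ((a ∩ E) ∪ Γ)) ≤ f (C ((b ∩ E) ∪ Γ)) :=
      hf (hCm (Finset.union_subset_union (Finset.inter_subset_inter_right hab) le_rfl))
    have h2 : f (C (E \ b)) ≤ f (C (E \ a)) := hf (hCm (Finset.sdiff_subset_sdiff le_rfl hab))
    simp only [hΦ]; linarith
  have hΨm : Monotone Ψ := by
    intro a b hab
    have h1 : g (C ((a ∩ E) ∪ Γ)) ≤ g (C ((b ∩ E) ∪ Γ)) :=
      hg (hCm (Finset.union_subset_union (Finset.inter_subset_inter_right hab) le_rfl))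
    have h2 : g (C (E \ b)) ≤ g (C (E \ a)) := hg (hCm (Finset.sdiff_subset_sdiff le_rfl hab))
    simp only [hΨ]; linarith
  have hΦE : ∀ ω ∈ E.powerset, Φ ω = f (C (ω ∪ Γ)) - f (C (E \ ω)) := fun ω hω => by
    simp only [hΦ, Finset.inter_eq_left.mpr (Finset.mem_powerset.mp hω)]
  have hΨE : ∀ ω ∈ E.powerset, Ψ ω = g (C (ω ∪ Γ)) - g (C (E \ ω)) := fun ω hω => by
    simp only [hΨ, Finset.inter_eq_left.mpr (Finset.mem_powerset.mp hω)]
  -- the sums of the differences are non-negative (gadget monotonicity + colour swap)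
  have hΦ0 : 0 ≤ ∑ ω ∈ E.powerset, Φ ω := by
    rw [Finset.sum_congr rfl hΦE, Finset.sum_sub_distrib, sum_powerset_sdiff E (fun ω => f (C ω)), ← Finset.sum_sub_distrib]
    exact Finset.sum_nonneg fun ω _ => sub_nonneg.mpr (hf (hCm Finset.subset_union_left))
  have hΨ0 : 0 ≤ ∑ ω ∈ E.powerset, Ψ ω := by
    rw [Finset.sum_congr rfl hΨE, Finset.sum_sub_distrib, sum_powerset_sdiff E (fun ω => g (C ω)), ← Finset.sum_sub_distrib]
    exact Finset.sum_nonneg fun ω _ => sub_nonneg.mpr (hg (hCm Finset.subset_union_left))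
  have key := fkg_powerset E Φ Ψ hΦm hΨm
  have hrw : ∑ ω ∈ E.powerset, Φ ω * Ψ ω =
      ∑ ω ∈ E.powerset, (f (C (ω ∪ Γ)) - f (C (E \ ω))) * (g (C (ω ∪ Γ)) - g (C (E \ ω))) :=
    Finset.sum_congr rfl fun ω hω => by rw [hΦE ω hω, hΨE ω hω]
  rw [hrw] at key
  have hpos : (0 : ℝ) < (2 ^ E.card : ℝ) := by positivity
  exact (mul_nonneg_iff_of_pos_left hpos).mp (le_trans (mul_nonneg hΦ0 hΨ0) key)

open Classical in
/-- **The REACH reduction** (prim-lf-2 gen 40).  Fix a multigraph `ends`, a root `x`, a vertex `z` and monotone `f, g`.  Suppose the gadget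
REACH principle holds for `ends, x, z, f, g`: for all disjoint edge sets `E, Γ`,
`0 ≤ Σ_{ω ⊆ E} 1{z ∈ C(ω ∪ Γ)} (f C(ω ∪ Γ) − f C(E ∖ ω)) (g C(ω ∪ Γ) − g C(E ∖ ω))`.  Then the DECIDED-weight two-colouring inequality holds:
`0 ≤ Σ_{s : z ∈ C(s), z ∉ C(sᶜ)} (f C(s) − f C(sᶜ)) (g C(s) − g C(sᶜ))`  (`= T''(z) ≥ 0` of CW-PROGRAMME-gen21, by the colour swap).
Proof: cells of the blue cluster of `z`; each cell is the REACH sum of the gadget instance (edges off the blue cluster, red edges at it).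
[cite: KozmaNitzan2024, Questions 8–9 (§5.5 p. 36) (context)] -/
theorem decided_twoColouring_nonneg_of_reach (ends : ι → Sym2 V) (x z : V) (f g : Set V → ℝ)
    (hreach : ∀ E Γ : Finset ι, Disjoint E Γ →
      0 ≤ ∑ ω ∈ E.powerset, if z ∈ openCluster (ends '' (↑(ω ∪ Γ) : Set ι)) x then
        (f (openCluster (ends '' (↑(ω ∪ Γ) : Set ι)) x) - f (openCluster (ends '' (↑(E \ ω) : Set ι)) x)) *
          (g (openCluster (ends '' (↑(ω ∪ Γ) : Set ι)) x) - g (openCluster (ends '' (↑(E \ ω) : Set ι)) x)) else 0) :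
    0 ≤ ∑ s ∈ univ.filter (fun s : Finset ι =>
        z ∈ openCluster (ends '' (↑s : Set ι)) x ∧ z ∉ openCluster (ends '' (↑(sᶜ) : Set ι)) x),
      (f (openCluster (ends '' (↑s : Set ι)) x) - f (openCluster (ends '' (↑(sᶜ) : Set ι)) x)) *
        (g (openCluster (ends '' (↑s : Set ι)) x) - g (openCluster (ends '' (↑(sᶜ) : Set ι)) x)) := by
  -- notation
  set K : Finset ι → Set V := fun s => openCluster (ends '' (↑s : Set ι)) x with hK
  set Φ : Finset ι → ℝ := fun s => (f (K s) - f (K sᶜ)) * (g (K s) - g (K sᶜ)) with hΦ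
  -- rewrite the restricted sum as a weighted sum over the event `{z ∉ C(sᶜ)}`
  set D : Finset (Finset ι) := univ.filter (fun s : Finset ι => z ∉ openCluster (ends '' (↑(sᶜ) : Set ι)) x) with hD
  have hsplit : ∑ s ∈ univ.filter (fun s : Finset ι =>
        z ∈ openCluster (ends '' (↑s : Set ι)) x ∧ z ∉ openCluster (ends '' (↑(sᶜ) : Set ι)) x), Φ s =
      ∑ s ∈ D, if z ∈ K s then Φ s else 0 := by
    rw [Finset.sum_ite, Finset.sum_const_zero, add_zero]
    refine Finset.sum_congr ?_ fun _ _ => rfl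
    ext s
    simp only [hD, Finset.mem_filter, Finset.mem_univ, true_and, hK]
    tauto
  change 0 ≤ ∑ s ∈ univ.filter (fun s : Finset ι =>
        z ∈ openCluster (ends '' (↑s : Set ι)) x ∧ z ∉ openCluster (ends '' (↑(sᶜ) : Set ι)) x), Φ s
  rw [hsplit]
  -- the blue cluster of `z`, the edges at a vertex set, and the cell key
  set Bl : Finset ι → Set V := fun s => openCluster (ends '' (↑(sᶜ) : Set ι)) z with hBl
  set I : Set V → Finset ι := fun S => univ.filter (fun i : ι => ∃ v ∈ S, v ∈ ends i) with hI
  set key : Finset ι → Set V × Finset ι := fun s => (Bl s, s ∩ I (Bl s)) with hkey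
  have Bl_closed : ∀ (s : Finset ι) {u w : V}, u ∈ Bl s → (openGraph (ends '' (↑(sᶜ) : Set ι))).Adj u w → w ∈ Bl s :=
    fun s u w hu hadj => SimpleGraph.Reachable.trans hu hadj.reachable
  have mem_I : ∀ (S : Set V) (i : ι) (v : V), v ∈ S → v ∈ ends i → i ∈ I S := by
    intro S i v hv hvi
    simp only [hI, Finset.mem_filter, Finset.mem_univ, true_and]
    exact ⟨v, hv, hvi⟩
  have z_mem_Bl : ∀ s : Finset ι, z ∈ Bl s := fun s => mem_openCluster_self _ z
  -- (L1) locality: agreeing with `s₀` on the edges at `Bl s₀` forces the same blue cluster of `z`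
  have locality : ∀ s₀ t : Finset ι, t ∩ I (Bl s₀) = s₀ ∩ I (Bl s₀) → Bl t = Bl s₀ := by
    intro s₀ t ht
    have agree : ∀ i, i ∈ I (Bl s₀) → (i ∈ t ↔ i ∈ s₀) := by
      intro i hi
      have := congrArg (fun u : Finset ι => i ∈ u) ht
      simp only [Finset.mem_inter, hi, and_true, eq_iff_iff] at this
      exact this
    have agreec : ∀ i, i ∈ I (Bl s₀) → (i ∈ tᶜ ↔ i ∈ s₀ᶜ) := fun i hi => by
      rw [Finset.mem_compl, Finset.mem_compl, agree i hi]
    have h1 : ∀ u ∈ Bl s₀, ∀ w, (openGraph (ends '' (↑(s₀ᶜ) : Set ι))).Adj u w →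
        (openGraph (ends '' (↑(tᶜ) : Set ι))).Adj u w ∧ w ∈ Bl s₀ := by
      intro u hu w hadj
      refine ⟨?_, Bl_closed s₀ hu hadj⟩
      rw [openGraph_image_adj] at hadj ⊢
      obtain ⟨⟨i, his, hi⟩, hne⟩ := hadj
      have hiI : i ∈ I (Bl s₀) := mem_I _ i u hu (by rw [hi]; exact Sym2.mem_mk_left u w)
      exact ⟨⟨i, (agreec i hiI).mpr his, hi⟩, hne⟩
    have h2 : ∀ u ∈ Bl s₀, ∀ w, (openGraph (ends '' (↑(tᶜ) : Set ι))).Adj u w →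
        (openGraph (ends '' (↑(s₀ᶜ) : Set ι))).Adj u w ∧ w ∈ Bl s₀ := by
      intro u hu w hadj
      have hadj' : (openGraph (ends '' (↑(s₀ᶜ) : Set ι))).Adj u w := by
        rw [openGraph_image_adj] at hadj ⊢
        obtain ⟨⟨i, hit, hi⟩, hne⟩ := hadj
        have hiI : i ∈ I (Bl s₀) := mem_I _ i u hu (by rw [hi]; exact Sym2.mem_mk_left u w)
        exact ⟨⟨i, (agreec i hiI).mp hit, hi⟩, hne⟩
      exact ⟨hadj', Bl_closed s₀ hu hadj'⟩
    ext y
    constructor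
    · intro hy
      obtain ⟨p⟩ := hy
      exact ((reachable_transfer (Bl s₀) h2 p) (z_mem_Bl s₀)).2
    · intro hy
      obtain ⟨p⟩ := hy
      exact ((reachable_transfer (Bl s₀) h1 p) (z_mem_Bl s₀)).1
  -- split the sum over `D` along the fibres of `key`
  rw [← Finset.sum_fiberwise_of_maps_to (s := D) (t := D.image key) (g := key)
    (fun s hs => Finset.mem_image_of_mem key hs)]
  refine Finset.sum_nonneg fun k hk => ?_
  obtain ⟨s₀, hs₀D, rfl⟩ := Finset.mem_image.mp hk
  have hs₀ : z ∉ K s₀ᶜ := by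
    have := (Finset.mem_filter.mp hs₀D).2
    simpa [hK] using this
  -- frozen data of the cell of `s₀`
  set S₀ : Set V := Bl s₀ with hS₀
  set B : Finset ι := I S₀ with hB
  set π : Finset ι := s₀ ∩ B with hπ
  have hxS₀ : x ∉ S₀ := fun hx => hs₀ (SimpleGraph.Reachable.symm hx)
  have hπB : π ⊆ B := Finset.inter_subset_right
  -- (L2) the fibre of `key s₀` in `D` is exactly the cell `{t | t ∩ B = π}`
  have fiber_eq : D.filter (fun t => key t = key s₀) = univ.filter (fun t : Finset ι => t ∩ B = π) := by
    ext t
    simp only [Finset.mem_filter, Finset.mem_univ, true_and]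
    constructor
    · rintro ⟨_, hkt⟩
      have h1 : Bl t = S₀ := (Prod.ext_iff.mp hkt).1
      have h2 : t ∩ I (Bl t) = s₀ ∩ I (Bl s₀) := (Prod.ext_iff.mp hkt).2
      rw [h1] at h2
      exact h2
    · intro ht
      have hBt : Bl t = S₀ := locality s₀ t ht
      refine ⟨?_, ?_⟩
      · rw [hD, Finset.mem_filter]
        refine ⟨Finset.mem_univ _, fun hzt => ?_⟩
        have hxBt : x ∈ Bl t := SimpleGraph.Reachable.symm hzt
        rw [hBt] at hxBt
        exact hxS₀ hxBt
      · change (Bl t, t ∩ I (Bl t)) = (Bl s₀, s₀ ∩ I (Bl s₀))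
        rw [hBt]
        exact Prod.ext rfl ht
  rw [fiber_eq]
  -- (L3) on the cell, the blue cluster of `x` uses no edge at `S₀`: `K(tᶜ) = K(tᶜ ∖ B)`
  have blue_off : ∀ t : Finset ι, t ∩ B = π → K tᶜ = K (tᶜ \ B) := by
    intro t ht
    have agree : ∀ i, i ∈ B → (i ∈ t ↔ i ∈ s₀) := by
      intro i hi
      have := congrArg (fun u : Finset ι => i ∈ u) ht
      simp only [hπ, Finset.mem_inter, hi, and_true, eq_iff_iff] at this
      exact this
    have hBt : Bl t = S₀ := locality s₀ t ht
    apply Set.Subset.antisymm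
    · -- a blue walk from `x ∉ S₀` never meets `S₀`, hence uses no edge at `S₀`
      have htr : ∀ u ∈ S₀ᶜ, ∀ w, (openGraph (ends '' (↑(tᶜ) : Set ι))).Adj u w →
          (openGraph (ends '' (↑(tᶜ \ B) : Set ι))).Adj u w ∧ w ∈ S₀ᶜ := by
        intro u hu w hadj
        have hadj0 := hadj
        rw [openGraph_image_adj] at hadj
        obtain ⟨⟨i, hit, hi⟩, hne⟩ := hadj
        -- `w ∉ S₀`: otherwise the blue edge `i` would put `u` into the blue cluster of `z`
        have hwS : w ∈ S₀ᶜ := by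
          intro hwS
          have hwBt : w ∈ Bl t := by rw [hBt]; exact hwS
          have huBt : u ∈ Bl t := Bl_closed t hwBt (hadj0.symm)
          rw [hBt] at huBt
          exact hu huBt
        have hiB : i ∉ B := by
          intro hiB
          have hiB' := hiB
          simp only [hB, hI, Finset.mem_filter, Finset.mem_univ, true_and] at hiB'
          obtain ⟨v, hvS, hvi⟩ := hiB'
          rw [hi, Sym2.mem_iff] at hvi
          rcases hvi with rfl | rfl
          · exact hu hvS
          · exact hwS hvS
        refine ⟨?_, hwS⟩
        rw [openGraph_image_adj]
        exact ⟨⟨i, Finset.mem_sdiff.mpr ⟨hit, hiB⟩, hi⟩, hne⟩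
      intro y hy
      obtain ⟨p⟩ := hy
      exact ((reachable_transfer S₀ᶜ htr p) hxS₀).1
    · exact openCluster_image_mono ends Finset.sdiff_subset x
  -- (L4) on the cell, `t = (t ∖ B) ∪ π` and `tᶜ ∖ B = Bᶜ ∖ (t ∖ B)`
  have red_eq : ∀ t : Finset ι, t ∩ B = π → t = (t \ B) ∪ π := by
    intro t ht
    rw [← ht]
    ext i
    simp only [Finset.mem_union, Finset.mem_sdiff, Finset.mem_inter]
    tauto
  have blue_eq : ∀ t : Finset ι, tᶜ \ B = Bᶜ \ (t \ B) := by
    intro t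
    ext i
    simp only [Finset.mem_sdiff, Finset.mem_compl]
    tauto
  -- reindex the cell by `t ↦ t ∖ B ∈ (Bᶜ).powerset` and recognise the REACH sum of the gadget instance `(Bᶜ, π)`
  have hcell_sum : ∑ t ∈ univ.filter (fun t : Finset ι => t ∩ B = π), (if z ∈ K t then Φ t else 0) =
      ∑ ω ∈ (Bᶜ).powerset, (if z ∈ K (ω ∪ π) then
        (f (K (ω ∪ π)) - f (K (Bᶜ \ ω))) * (g (K (ω ∪ π)) - g (K (Bᶜ \ ω))) else 0) := by
    refine Finset.sum_bij' (fun t _ => t \ B) (fun ω _ => ω ∪ π) ?_ ?_ ?_ ?_ ?_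
    · intro t _
      exact Finset.mem_powerset.mpr (fun i hi => Finset.mem_compl.mpr (Finset.mem_sdiff.mp hi).2)
    · intro ω hω
      have hωB : Disjoint ω B := by
        rw [Finset.disjoint_left]
        intro i hi hiB
        exact (Finset.mem_compl.mp (Finset.mem_powerset.mp hω hi)) hiB
      simp only [Finset.mem_filter, Finset.mem_univ, true_and]
      rw [Finset.union_inter_distrib_right, Finset.disjoint_iff_inter_eq_empty.mp hωB, Finset.empty_union]
      exact Finset.inter_eq_left.mpr hπB
    · intro t ht
      have ht' : t ∩ B = π := (Finset.mem_filter.mp ht).2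
      exact (red_eq t ht').symm
    · intro ω hω
      have hωB : Disjoint ω B := by
        rw [Finset.disjoint_left]
        intro i hi hiB
        exact (Finset.mem_compl.mp (Finset.mem_powerset.mp hω hi)) hiB
      rw [Finset.union_sdiff_distrib, Finset.sdiff_eq_self_of_disjoint hωB,
        Finset.sdiff_eq_empty_iff_subset.mpr hπB, Finset.union_empty]
    · intro t ht
      have ht' : t ∩ B = π := (Finset.mem_filter.mp ht).2
      have h1 : K t = K ((t \ B) ∪ π) := by rw [← red_eq t ht']
      have h2 : K tᶜ = K (Bᶜ \ (t \ B)) := by rw [blue_off t ht', blue_eq t]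
      simp only [hΦ]
      rw [← h1, ← h2]
  rw [hcell_sum]
  have hdisj : Disjoint Bᶜ π := by
    rw [Finset.disjoint_left]
    intro i hi hiπ
    exact (Finset.mem_compl.mp hi) (hπB hiπ)
  exact hreach Bᶜ π hdisj

end Coefficientwise

end Summit.CriticalPhenomena.PercolationContinuityZ3.Theorems
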